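import Mathlib
import Summits.Ventures.PercRepro2.TypedStarGenCore

/-!
# THE PLACEMENT SUM IS SYMMETRIC IN THE STAR LIST (blind cell PercRepro2, mine-2 g41, 2026-08-29;
`proofs/MINE2-GENSTAR.md` §5)

`placeSum` (TypedStarGenK5.lean) is invariant under permutations of the star list: the nested sums
commute and the clique masks are symmetric (`placeSum_swap`, `placeSum_perm`).  Hence `StarNonnegGen`
at a star list follows from `StarNonnegGen` at any permutation of it (`StarNonnegGen.of_perm`), and the
certificates at the SORTED star lists suffice (the dispatch of `K5StarGenAll.lean`).

Own code; standard axioms.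
-/

namespace Summit.Ventures.PercRepro2

open Hub

namespace K5

section Perm

variable {R : Type*} [Field R]

/-- A conditional on a triple sum over `Bool` is the triple sum of the conditionals. -/
lemma ite_sum_bool3 (c : Prop) [Decidable c] (g : Bool → Bool → Bool → R) :
    (if c then ∑ a, ∑ b, ∑ d, g a b d else 0) = ∑ a, ∑ b, ∑ d, if c then g a b d else 0 := by
  split_ifs <;> simp

/-- Two nested conditionals on the same default commute. -/
lemma ite_ite_comm (c c' : Prop) [Decidable c] [Decidable c'] (x : R) :
    (if c then (if c' then x else 0) else 0) = if c' then (if c then x else 0) else 0 := by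
  split_ifs <;> rfl

/-- Exchanging two adjacent star edges does not change the placement sum. -/
theorem placeSum_swap (F : Finset (Fin 10)) (z : Config (Fin 10)) (τ : Fin 10 → ℕ)
    (K : Config (Fin 10) → Config (Fin 10) → Config (Fin 10) → R) (p q : Fin 5) (t u : ℕ)
    (L : List (Fin 5 × ℕ)) (s₁ s₂ s₃ : Finset (Fin 5)) :
    placeSum F z τ K ((p, t) :: (q, u) :: L) s₁ s₂ s₃ =
      placeSum F z τ K ((q, u) :: (p, t) :: L) s₁ s₂ s₃ := by
  simp only [placeSum, ite_sum_bool3]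
  simp only [Fintype.sum_bool, Bool.false_eq_true, ite_true, ite_false]
  simp only [Finset.insert_comm p q]
  conv_rhs => simp only [ite_ite_comm (_ = u) (_ = t)]
  ring

/-- **The placement sum is invariant under permutations of the star list.** -/
theorem placeSum_perm (F : Finset (Fin 10)) (z : Config (Fin 10)) (τ : Fin 10 → ℕ)
    (K : Config (Fin 10) → Config (Fin 10) → Config (Fin 10) → R) {L L' : List (Fin 5 × ℕ)}
    (h : L.Perm L') : ∀ s₁ s₂ s₃ : Finset (Fin 5),
      placeSum F z τ K L s₁ s₂ s₃ = placeSum F z τ K L' s₁ s₂ s₃ := by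
  induction h with
  | nil => intro s₁ s₂ s₃; rfl
  | cons x _ ih =>
    intro s₁ s₂ s₃
    obtain ⟨p, t⟩ := x
    simp only [placeSum]
    refine Finset.sum_congr rfl fun a _ => Finset.sum_congr rfl fun b _ =>
      Finset.sum_congr rfl fun c _ => ?_
    split_ifs <;> first | exact ih _ _ _ | rfl
  | swap x y l =>
    intro s₁ s₂ s₃
    obtain ⟨p, t⟩ := x
    obtain ⟨q, u⟩ := y
    exact placeSum_swap F z τ K q p u t l s₁ s₂ s₃
  | trans _ _ ih₁ ih₂ =>
    intro s₁ s₂ s₃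
    rw [ih₁, ih₂]

variable [LinearOrder R]

/-- `StarNonnegGen` transfers along permutations of the star list. -/
theorem StarNonnegGen.of_perm {o a₁ a₂ a₃ b : Fin 5} {L L' : List (Fin 5 × ℕ)} (h : L.Perm L')
    (hL' : StarNonnegGen R o a₁ a₂ a₃ b L') : StarNonnegGen R o a₁ a₂ a₃ b L := by
  intro F τ hF
  rw [placeSum_perm F _ τ _ h]
  exact hL' F τ hF

end Perm

end K5

end Summit.Ventures.PercRepro2
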